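import Literature.IUT.HodgeArakelov.GaloisPairCyclotomesThetaSyncScalar
import Literature.AnabelianGeometry.SemiGraphs.TemperedCurveGaloisCyclotome
import HarnessLib

/-!
# Bridge B12, `Π`-side at Cor. 1.10's GENUINE family — the GALOIS half (E) is DISCHARGED down to the [EtTh] §1 sentence
# «`Δ_Θ ≅ Ẑ(1)` as a `G_K`-module» (proof-only)

Mochizuki, *Inter-universal Teichmüller theory II*, §1, Cor. 1.11 (b), kurims manuscript (Dec. 2020) p. 49 ll. 22–35
("the natural isomorphism `μ_Ẑ(G_k) ⥲ μ_Ẑ(Π_X)` of [AbsTopIII], Corollary 1.10, (c)", "the topological `Π`-module …")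
[claim: Mochizuki2012, status: disputed] (IUTchII §1 Cor 1.11, kurims p.49); [EtTh] §1 p. 12 (PRIMS p. 238) "`Δ_Θ (≅ Ẑ(1))`"
[cite: MochizukiEtTh2009, §1 p.12]; [AbsTopIII] Cor. 1.10 (i)(a) p. 42 [cite: MochizukiAbsTopIII2015, Cor 1.10 (i) p.42].
Record-only typing under the claim key `Mochizuki2012` (D-0012, disputed); abc-iut cell, layer L6, node `IUTchII:Cor1.11`
(B12 `Π`-side) over `IUTchII:Cor1.10`; seat abc-iut-w5-d145 (gen 3); GAP-LEDGER row G-w5d145-1.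

STATE BEFORE THIS FILE (`GaloisPairCyclotomesThetaSyncScalar`, p428581): at abc-iut-w4-d038's genuine family `familyLim`,
`Nonempty (GalCorPiXInput A familyLim)` ⟺ [(l·Δ_Θ)(𝕄_*) and `μ_Ẑ(Π^tp_{X̲̲}/Δ)` abstractly isomorphic] ∧ ∀ iso `c`: (E) `c` is
`Π^tp_{X̲̲}`-equivariant ∧ (C) `c` is `Aut(Π^tp_{X̲̲})`-compatible — (E), (C) being independent of `c`.

THIS FILE discharges the GALOIS SIDE of (E) unconditionally, using the junction `TemperedCurve.exists_muZhat_GK_mulEquiv_cyclotome`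
(p430343: `μ_Ẑ(G_K) ≅ Λ(ℚ̄_pˣ)` `G_K`-equivariantly, from abc-iut-L4's local class field theory at `ℚ_p` and the equivariant
open-subgroup invariance `GaloisCyclotomeOpenSubgroupAction`, p429644):
* `AbsTopMonoids.exists_hom_quotObj_base_eq_aug` — for ANY setting with `G_k` compact Hausdorff and any Ex. 1.8 interface `A`,
  the CANONICAL comparison `Π/Δ ⥲ G_k`, `[x] ↦ aug x`, IS a morphism of `IsoClass G_k` (a homeomorphic isomorphism): the
  interface's `quotIso` makes `Π/Δ` compact, `aug` is continuous, and a continuous bijection compact → Hausdorff is a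
  homeomorphism — so the intrinsic `Π`-module `μ_Ẑ(Π/Δ)` of Cor. 1.11 (b) is `μ_Ẑ(G_k)` with `Π` acting through `aug`;
* **`EtaleLevels.exists_galCyclotome_basePointLim_equivariant`** — at the genuine [EtTh]-model setting: an isomorphism
  `F : μ_Ẑ(Π^tp_{X̲̲}/Δ) ⥲ Λ(ℚ̄_pˣ)` with `F([x] · ζ)_n = aug(x) (F ζ)_n`: the `Π^tp_{X̲̲}`-module `μ_Ẑ(Π^tp_{X̲̲}/Δ)` of Cor. 1.11 (b) IS
  `Ẑ(1) = Λ(ℚ̄_pˣ)` with the (field-theoretic) cyclotomic action — [AbsTopIII] Cor. 1.10 (i)(a) + [AbsAnab] Prop. 1.2.1 (vi)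
  PROVED at this setting;
* **`EtaleLevels.equivariant_iff_thetaSide`** — hence condition (E) (for some / every `c`) is EQUIVALENT to the purely
  [EtTh]-side sentence (E_Θ): «there is an isomorphism `(l·Δ_Θ)(𝕄_*) ⥲ Λ(ℚ̄_pˣ)` carrying the conjugation action of `Π^tp_{X̲̲}`
  to the Galois action through `aug`» — VERBATIM [EtTh] §1 p. 12 "`Δ_Θ (≅ Ẑ(1))`" as a `G_K`-module for the tree's
  `(l·Δ_Θ)(𝕄_*) = (l·Δ_Θ)/thetaKer` (`Setting.lean` v3 «Deferred TRANSCRIPTIONS»; the family's binder `mods`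
  (`CyclotomeMod.red_conj`) is its levelwise form);
* **`EtaleLevels.nonempty_galCorPiXInput_familyLim_iff_thetaSide`** — the `Π`-side residual of Cor. 1.11 (b) at the genuine
  family = (E_Θ) ∧ (C) (for every `c`): GAP-LEDGER G-w5d145-1 is REDUCED to its L2 half (E_Θ), G-w5d145-2 unchanged.
HONEST FRAMING: proof-only bookkeeping over typed interfaces plus classical local class field theory as proved in the tree;
(E_Θ) and (C) are NOT proved here; nothing here bears on [IUTchIII] Cor. 3.12; typed ≠ discharged.
-/

noncomputable section

namespace Literature.IUT.HodgeArakelov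

open CategoryTheory
open Literature.AnabelianGeometry.AbsoluteAnabelian
open Literature.IUT.HodgeTheaters (ZHat)

universe u

/-! ## The canonical comparison `Π/Δ ⥲ G_k` is a morphism of `IsoClass G_k` -/

namespace AbsTopMonoids

variable {S : ThetaSetting.{u}} (A : AbsTopMonoids S)

/-- **The canonical isomorphism `Π^tp_{X̲̲_k}/Δ ⥲ G_k`, `[x] ↦ aug(x)`, is a morphism of `IsoClass G_k`** (a homeomorphic group
isomorphism) whenever `G_k` is compact Hausdorff: `Δ = Ker(aug)` on the reference object (`Delta_base`), the induced
bijection is continuous (quotient topology), `Π/Δ` is compact (it is homeomorphic to `G_k` by the interface's `quotIso`), and a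
continuous bijection from a compact space to a Hausdorff space is a homeomorphism. So the "topological `Π`-module"
`μ_Ẑ(Π/Δ)` of [IUTchII] Cor. 1.11 (b) at the reference object is `μ_Ẑ(G_k)` with `Π` acting through `aug`.
[claim: Mochizuki2012, status: disputed] (IUTchII §1 Ex 1.8 (i), kurims pp.35-36) -/
theorem exists_hom_quotObj_base_eq_aug [CompactSpace S.Gk] [T2Space S.Gk] :
    ∃ e : A.quotObj (IsoClass.base S.PiX) ⟶ IsoClass.base S.Gk,
      ∀ x : (IsoClass.base S.PiX).G,
        IsoClass.homIso e (QuotientGroup.mk x : (IsoClass.base S.PiX).G ⧸ A.Delta (IsoClass.base S.PiX)) = S.aug x := by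
  have hΔ : A.Delta (IsoClass.base S.PiX) = S.aug.ker := A.Delta_base
  let φ₀ : ((IsoClass.base S.PiX).G ⧸ A.Delta (IsoClass.base S.PiX)) →* S.Gk :=
    QuotientGroup.lift (A.Delta (IsoClass.base S.PiX)) S.aug hΔ.le
  have hφ₀ : ∀ x : (IsoClass.base S.PiX).G, φ₀ (QuotientGroup.mk x) = S.aug x := fun x => rfl
  have hinj : Function.Injective φ₀ := by
    rw [← MonoidHom.ker_eq_bot_iff, eq_bot_iff]
    intro q hq
    induction q using QuotientGroup.induction_on with
    | H x =>
      rw [MonoidHom.mem_ker, hφ₀] at hq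
      have hx : x ∈ A.Delta (IsoClass.base S.PiX) := hΔ ▸ (MonoidHom.mem_ker.2 hq)
      exact (Subgroup.mem_bot).2 ((QuotientGroup.eq_one_iff x).2 hx)
  have hsurj : Function.Surjective φ₀ := fun g => by
    obtain ⟨x, hx⟩ := S.aug_surjective g
    exact ⟨QuotientGroup.mk x, hx⟩
  let φ : ((IsoClass.base S.PiX).G ⧸ A.Delta (IsoClass.base S.PiX)) ≃* S.Gk := MulEquiv.ofBijective φ₀ ⟨hinj, hsurj⟩
  have hφ : ∀ x : (IsoClass.base S.PiX).G, φ (QuotientGroup.mk x) = S.aug x := fun x => rfl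
  have hcont : Continuous φ := by
    refine (QuotientGroup.isQuotientMap_mk (A.Delta (IsoClass.base S.PiX))).continuous_iff.2 ?_
    exact S.aug_continuous.congr fun x => (hφ x).symm
  obtain ⟨e₀⟩ := A.quotIso (IsoClass.base S.PiX)
  haveI : CompactSpace ((IsoClass.base S.PiX).G ⧸ A.Delta (IsoClass.base S.PiX)) := e₀.symm.toHomeomorph.compactSpace
  let ψ : ((IsoClass.base S.PiX).G ⧸ A.Delta (IsoClass.base S.PiX)) ≃ₜ S.Gk :=
    Continuous.homeoOfEquivCompactToT2 (f := φ.toEquiv) hcont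
  exact ⟨{ φ with continuous_toFun := hcont, continuous_invFun := ψ.symm.continuous }, hφ⟩

end AbsTopMonoids

/-! ## At the genuine natural system: the Galois side of (E), and the reduction of the residual to the [EtTh] side -/

namespace EtaleLevels

open Literature.AnabelianGeometry.EtaleTheta Literature.AnabelianGeometry.SemiGraphs
open scoped Literature.AnabelianGeometry.EtaleTheta

variable {p : ℕ} [Fact p.Prime] {D : Literature.AnabelianGeometry.EtaleTheta.ThetaSetting p}
  {E : D.EtaleThetaData} {l : ℕ} (C : E.DoubleUnderline l) (hC : D.Compat) (hS : D.Sec2Hyps)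
  (hl : l.Prime) (hp2 : p ≠ 2) (hpl : p ≠ l) (hζ : ∃ ζ : D.K, IsPrimitiveRoot ζ (4 * l))
  (mods : ∀ M : ℕ+, D.CyclotomeMod l M)
  (f : contCocycles D.toTheta D.DeltaTheta C.GtpYdduu) (hf : f ∈ C.rootCocycles hC)
  (hmods : ∀ (M M' : ℕ+) (h : (M : ℕ) ∣ (M' : ℕ)) (x : D.lDeltaTheta l),
    MuN.red p M M' h ((mods M').red x) = (mods M).red x)
  (h15 : Literature.AnabelianGeometry.EtaleTheta.ThetaSetting.Prop15iii E hC) (L : C.CuspLabels)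
  (hZ : ∀ M : ℕ+, Nonempty (ModelCyclotomes.lDeltaQuot (C.rigidData (mods M) hC hS h15 L) ≃*
    Literature.IUT.HodgeTheaters.ZHat))
  (h218i₁ : (levelRigid C hC hS mods h15 L 1).Cor218_i)

/-- The base point of the genuine family IS the reference object of the setting (bookkeeping, on the nose).
[claim: Mochizuki2012, status: disputed] (IUTchII §1 Cor 1.10, kurims p.47) -/
theorem basePointLim_eq_base :
    basePointLim C hC hS hl hp2 hpl hζ mods f hf hmods h15 L hZ =
      IsoClass.base (setting C hC hS hl hp2 hpl hζ mods f hf).PiX := rfl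

/-- `G_K` of the genuine setting is Hausdorff (it is the genuine Galois group `G_K ≤ Gal(ℚ̄_p/ℚ_p)` of the tempered curve).
[cite: MochizukiEtTh2009, §1 p.11] -/
theorem t2Space_Gk : T2Space (setting C hC hS hl hp2 hpl hζ mods f hf).Gk :=
  TemperedCurve.t2Space_GK D.toTemperedCurve

/-- `G_K` of the genuine setting is compact. [cite: MochizukiEtTh2009, §1 p.11] -/
theorem compactSpace_Gk : CompactSpace (setting C hC hS hl hp2 hpl hζ mods f hf).Gk :=
  TemperedCurve.compactSpace_GK D.toTemperedCurve

/-- **The GALOIS SIDE of (E), PROVED at the genuine natural system**: for every Ex. 1.8 interface `A`, the intrinsic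
`Π^tp_{X̲̲}`-module `μ_Ẑ(Π^tp_{X̲̲}/Δ)` of [IUTchII] Cor. 1.11 (b) (abc-iut-L4-t1's group-theoretic cyclotome of the quotient, with
`Π^tp_{X̲̲}` acting by conjugation through `Π ↠ Π/Δ`) is `Ẑ(1) = Λ(ℚ̄_pˣ)` with `x ∈ Π^tp_{X̲̲}` acting by the field automorphism
`aug(x) ∈ G_K ≤ Gal(ℚ̄_p/ℚ_p)`: there is `F : μ_Ẑ(Π^tp_{X̲̲}/Δ) ⥲ Λ(ℚ̄_pˣ)` with `F([x]·ζ)_n = aug(x)((F ζ)_n)`. ([AbsTopIII]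
Cor. 1.10 (i)(a) + [AbsAnab] Prop. 1.2.1 (vi) at this setting: canonical `Π/Δ ⥲ G_K` + `μ_Ẑ(G_K) ≅ Λ(ℚ̄_pˣ)` equivariant.)
[claim: Mochizuki2012, status: disputed] (IUTchII §1 Cor 1.11, kurims p.49) -/
theorem exists_galCyclotome_basePointLim_equivariant [CompactSpace (setting C hC hS hl hp2 hpl hζ mods f hf).Gk]
    (A : AbsTopMonoids (setting C hC hS hl hp2 hpl hζ mods f hf)) :
    ∃ F : ↥(A.quotObj (basePointLim C hC hS hl hp2 hpl hζ mods f hf hmods h15 L hZ)).galCyclotome ≃*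
        Literature.AnabelianGeometry.EtaleTheta.cyclotome (AlgebraicClosure ℚ_[p])ˣ,
      ∀ (x : (basePointLim C hC hS hl hp2 hpl hζ mods f hf hmods h15 L hZ).G)
        (ζ : (A.quotObj (basePointLim C hC hS hl hp2 hpl hζ mods f hf hmods h15 L hZ)).galCyclotome) (n : ℕ+),
        ((((F (haveI := (A.quotObj (basePointLim C hC hS hl hp2 hpl hζ mods f hf hmods h15 L hZ)).compactSpace_carrier;
              (QuotientGroup.mk x : _ ⧸ A.Delta _) • ζ) : Literature.AnabelianGeometry.EtaleTheta.cyclotome (AlgebraicClosure ℚ_[p])ˣ) :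
              ℕ+ → (AlgebraicClosure ℚ_[p])ˣ) n : (AlgebraicClosure ℚ_[p])ˣ) : AlgebraicClosure ℚ_[p]) =
          (D.aug (Subtype.val x))
            ((((F ζ : Literature.AnabelianGeometry.EtaleTheta.cyclotome (AlgebraicClosure ℚ_[p])ˣ) : ℕ+ → (AlgebraicClosure ℚ_[p])ˣ) n :
              (AlgebraicClosure ℚ_[p])ˣ) : AlgebraicClosure ℚ_[p]) := by
  haveI := t2Space_Gk C hC hS hl hp2 hpl hζ mods f hf
  haveI : CompactSpace D.toTemperedCurve.GK := TemperedCurve.compactSpace_GK D.toTemperedCurve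
  obtain ⟨e, he⟩ := A.exists_hom_quotObj_base_eq_aug
  obtain ⟨g, hg⟩ := TemperedCurve.exists_muZhat_GK_mulEquiv_cyclotome D.toTemperedCurve
  -- `μ_Ẑ` of the reference object of `IsoClass G_K` is `μ_Ẑ(G_K)` (same group, same topology)
  refine ⟨(IsoClass.galCyclotomeMap e).trans g, fun x ζ n => ?_⟩
  haveI := (A.quotObj (basePointLim C hC hS hl hp2 hpl hζ mods f hf hmods h15 L hZ)).compactSpace_carrier
  have he' : ∀ y : (basePointLim C hC hS hl hp2 hpl hζ mods f hf hmods h15 L hZ).G,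
      IsoClass.homIso e (QuotientGroup.mk y : _ ⧸ A.Delta (basePointLim C hC hS hl hp2 hpl hζ mods f hf hmods h15 L hZ)) =
        (setting C hC hS hl hp2 hpl hζ mods f hf).aug y := he
  have h1 := IsoClass.galCyclotomeMap_smul e
    (QuotientGroup.mk x : _ ⧸ A.Delta (basePointLim C hC hS hl hp2 hpl hζ mods f hf hmods h15 L hZ)) ζ
  rw [he'] at h1
  have h2 := hg ((setting C hC hS hl hp2 hpl hζ mods f hf).aug x) (IsoClass.galCyclotomeMap e ζ) n
  have h4 := congrArg (fun y => ((((g y : Literature.AnabelianGeometry.EtaleTheta.cyclotome (AlgebraicClosure ℚ_[p])ˣ) :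
    ℕ+ → (AlgebraicClosure ℚ_[p])ˣ) n : (AlgebraicClosure ℚ_[p])ˣ) : AlgebraicClosure ℚ_[p])) h1
  exact h4.trans h2

/-- **(E) ⟺ (E_Θ) at the genuine natural system.** Condition (E) of the `Π`-side residual (for SOME, equivalently EVERY,
isomorphism `c : μ_Ẑ(Π^tp_{X̲̲}/Δ) ⥲ (l·Δ_Θ)(𝕄_*)`) holds iff the purely [EtTh]-side sentence (E_Θ) does: «there is an isomorphism
`(l·Δ_Θ)(𝕄_*) ⥲ Λ(ℚ̄_pˣ) = Ẑ(1)` carrying the conjugation action of `x ∈ Π^tp_{X̲̲}` to the Galois action of `aug(x)`» — VERBATIM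
[EtTh] §1 p. 12 "`Δ_Θ (≅ Ẑ(1))`" AS A `G_K`-MODULE for the tree's `(l·Δ_Θ)(𝕄_*) = (l·Δ_Θ)/thetaKer` (the root interface
`Setting.lean` v3 lists it under «Deferred TRANSCRIPTIONS»; its levelwise shadow is the family's binder `mods`,
`CyclotomeMod.red_conj`). The Galois side is supplied by `exists_galCyclotome_basePointLim_equivariant`.
[claim: Mochizuki2012, status: disputed] (IUTchII §1 Cor 1.11, kurims p.49) -/
theorem equivariant_iff_thetaSide [CompactSpace (setting C hC hS hl hp2 hpl hζ mods f hf).Gk]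
    (A : AbsTopMonoids (setting C hC hS hl hp2 hpl hζ mods f hf)) :
    (∃ c : ↥(A.quotObj (basePointLim C hC hS hl hp2 hpl hζ mods f hf hmods h15 L hZ)).galCyclotome ≃*
          (baseDatumLim C hC hS hl hp2 hpl hζ mods f hf hmods h15 L hZ h218i₁).A,
        ∀ (x : (basePointLim C hC hS hl hp2 hpl hζ mods f hf hmods h15 L hZ).G)
            (ζ : (A.quotObj (basePointLim C hC hS hl hp2 hpl hζ mods f hf hmods h15 L hZ)).galCyclotome),
          c (haveI := (A.quotObj (basePointLim C hC hS hl hp2 hpl hζ mods f hf hmods h15 L hZ)).compactSpace_carrier;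
              (QuotientGroup.mk x : _ ⧸ A.Delta _) • ζ) =
            (baseDatumLim C hC hS hl hp2 hpl hζ mods f hf hmods h15 L hZ h218i₁).actA x (c ζ)) ↔
      ∃ t : ↥(baseDatumLim C hC hS hl hp2 hpl hζ mods f hf hmods h15 L hZ h218i₁).A ≃*
          Literature.AnabelianGeometry.EtaleTheta.cyclotome (AlgebraicClosure ℚ_[p])ˣ,
        ∀ (x : (basePointLim C hC hS hl hp2 hpl hζ mods f hf hmods h15 L hZ).G)
            (m : ↥(baseDatumLim C hC hS hl hp2 hpl hζ mods f hf hmods h15 L hZ h218i₁).A) (n : ℕ+),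
          ((((t ((baseDatumLim C hC hS hl hp2 hpl hζ mods f hf hmods h15 L hZ h218i₁).actA x m) :
              Literature.AnabelianGeometry.EtaleTheta.cyclotome (AlgebraicClosure ℚ_[p])ˣ) : ℕ+ → (AlgebraicClosure ℚ_[p])ˣ) n :
              (AlgebraicClosure ℚ_[p])ˣ) : AlgebraicClosure ℚ_[p]) =
            (D.aug (Subtype.val x))
              ((((t m : Literature.AnabelianGeometry.EtaleTheta.cyclotome (AlgebraicClosure ℚ_[p])ˣ) : ℕ+ → (AlgebraicClosure ℚ_[p])ˣ) n :
                (AlgebraicClosure ℚ_[p])ˣ) : AlgebraicClosure ℚ_[p]) := by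
  haveI := (A.quotObj (basePointLim C hC hS hl hp2 hpl hζ mods f hf hmods h15 L hZ)).compactSpace_carrier
  obtain ⟨F, hF⟩ := exists_galCyclotome_basePointLim_equivariant C hC hS hl hp2 hpl hζ mods f hf hmods h15 L hZ A
  constructor
  · rintro ⟨c, hc⟩
    refine ⟨c.symm.trans F, fun x m n => ?_⟩
    obtain ⟨ζ, rfl⟩ := c.surjective m
    rw [MulEquiv.trans_apply, MulEquiv.trans_apply, ← hc, MulEquiv.symm_apply_apply, MulEquiv.symm_apply_apply]
    exact hF x ζ n
  · rintro ⟨t, ht⟩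
    refine ⟨F.trans t.symm, fun x ζ => ?_⟩
    rw [MulEquiv.trans_apply, MulEquiv.trans_apply]
    apply t.injective
    rw [MulEquiv.apply_symm_apply]
    refine Subtype.ext (funext fun n => Units.ext ?_)
    rw [hF x ζ n, ht x _ n, MulEquiv.apply_symm_apply]

/-- **The `Π`-side residual of [IUTchII] Cor. 1.11 (b) AT THE GENUINE NATURAL SYSTEM, Galois side discharged**: for every
Ex. 1.8 interface `A`, `GalCorPiXInput A familyLim` is inhabited iff
(E_Θ) «`(l·Δ_Θ)(𝕄_*) ≅ Ẑ(1) = Λ(ℚ̄_pˣ)` as a `Π^tp_{X̲̲}`/`G_K`-module» ([EtTh] §1 p. 12; GAP-LEDGER G-w5d145-1, now purely L2-side) and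
(C) every isomorphism `μ_Ẑ(Π^tp_{X̲̲}/Δ) ⥲ (l·Δ_Θ)(𝕄_*)` is compatible with the `Aut(Π^tp_{X̲̲})`-actions ([AbsTopIII] Cor. 1.10 (c)
naturality + [EtTh] Cor. 2.19 (i); G-w5d145-2). [claim: Mochizuki2012, status: disputed] (IUTchII §1 Cor 1.11, kurims p.49) -/
theorem nonempty_galCorPiXInput_familyLim_iff_thetaSide [CompactSpace (setting C hC hS hl hp2 hpl hζ mods f hf).Gk]
    (A : AbsTopMonoids (setting C hC hS hl hp2 hpl hζ mods f hf)) :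
    Nonempty (GalCorPiXInput A (familyLim C hC hS hl hp2 hpl hζ mods f hf hmods h15 L hZ h218i₁)) ↔
      (∃ t : ↥(baseDatumLim C hC hS hl hp2 hpl hζ mods f hf hmods h15 L hZ h218i₁).A ≃*
          Literature.AnabelianGeometry.EtaleTheta.cyclotome (AlgebraicClosure ℚ_[p])ˣ,
        ∀ (x : (basePointLim C hC hS hl hp2 hpl hζ mods f hf hmods h15 L hZ).G)
            (m : ↥(baseDatumLim C hC hS hl hp2 hpl hζ mods f hf hmods h15 L hZ h218i₁).A) (n : ℕ+),
          ((((t ((baseDatumLim C hC hS hl hp2 hpl hζ mods f hf hmods h15 L hZ h218i₁).actA x m) :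
              Literature.AnabelianGeometry.EtaleTheta.cyclotome (AlgebraicClosure ℚ_[p])ˣ) : ℕ+ → (AlgebraicClosure ℚ_[p])ˣ) n :
              (AlgebraicClosure ℚ_[p])ˣ) : AlgebraicClosure ℚ_[p]) =
            (D.aug (Subtype.val x))
              ((((t m : Literature.AnabelianGeometry.EtaleTheta.cyclotome (AlgebraicClosure ℚ_[p])ˣ) : ℕ+ → (AlgebraicClosure ℚ_[p])ˣ) n :
                (AlgebraicClosure ℚ_[p])ˣ) : AlgebraicClosure ℚ_[p])) ∧
      ∀ (c : ↥(A.quotObj (basePointLim C hC hS hl hp2 hpl hζ mods f hf hmods h15 L hZ)).galCyclotome ≃*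
          (baseDatumLim C hC hS hl hp2 hpl hζ mods f hf hmods h15 L hZ h218i₁).A)
        (γ : basePointLim C hC hS hl hp2 hpl hζ mods f hf hmods h15 L hZ ⟶
              basePointLim C hC hS hl hp2 hpl hζ mods f hf hmods h15 L hZ)
        (ζ : (A.quotObj (basePointLim C hC hS hl hp2 hpl hζ mods f hf hmods h15 L hZ)).galCyclotome),
        c (IsoClass.galCyclotomeMap (A.quotMap γ) ζ) =
          (baseDatumLim C hC hS hl hp2 hpl hζ mods f hf hmods h15 L hZ h218i₁).rhoA (IsoClass.homIso γ) (c ζ) := by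
  have hA := nonempty_baseDatumLim_A_mulEquiv_zHat C hC hS hl hp2 hpl hζ mods f hf hmods h15 L hZ h218i₁
  rw [← equivariant_iff_thetaSide C hC hS hl hp2 hpl hζ mods f hf hmods h15 L hZ h218i₁ A,
    nonempty_galCorPiXInput_familyLim_iff C hC hS hl hp2 hpl hζ mods f hf hmods h15 L hZ h218i₁ A]
  constructor
  · rintro ⟨c, hE, hC'⟩
    exact ⟨⟨c, hE⟩, fun c' => GalCorPiXInput.compatible_transfer A _ hA c c' hC'⟩
  · rintro ⟨⟨c, hE⟩, hC'⟩
    exact ⟨c, hE, hC' c⟩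

end EtaleLevels

end Literature.IUT.HodgeArakelov

end
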